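import Summits.Schanuel.Schanuel.Theorems.SoloInformedAEAnalyticCore

/-!
# Lemma AE (kernel form): inexact additive coincidences among served roots are expensive

Soloist file (informed mode, seat `solo-Schanuel-informed`, s177).  This is LEMMA AE of the seat's
note `paper/AE-note.md` §2 as a kernel theorem, completing the chain
`SoloInformedSymmetricIntegrality` → `SoloInformedSquaredDifferenceIntegrality` (AE (i)) →
`SoloInformedAEAnalyticCore` (AE (ii)–(iii)) with the served-set bookkeeping of AE (ii).

Setting (`soloAE_lemmaAE`).  `F : ℤ[X]`, `F ≠ 0`, `natDegree F = D`, complex roots enumerated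
with multiplicity by `ρ : Fin D → ℂ` (NO squarefreeness is needed); `ξ η : ℂ`, `K : ℕ`,
`0 < ε ≤ 1/2` with `4 ε ≤ ‖ξ‖`; a finset `S` of naturals `≤ K` is SERVED: `ι : ℕ → Fin D` is
injective on `S` and `‖ρ (ι s) − (s ξ + η)‖ ≤ ε` for `s ∈ S`.  An (ordered) INEXACT ADDITIVE
COINCIDENCE is `c = ((s₁, s₂), (s₃, s₄))` with all `sᵢ ∈ S`, `s₂ < s₁`, `s₄ < s₃`,
`s₁ − s₂ = s₃ − s₄` (typed as `s₁ + s₄ = s₃ + s₂`) and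
`ρ (ι s₁) − ρ (ι s₂) ≠ ρ (ι s₃) − ρ (ι s₄)`.  For ANY finset `𝒞` of such coincidences, with
`ε' = 8 (K ‖ξ‖ + 1) ε` and `M = mahlerMeasure (F.map ℂ)`:

  `#𝒞 · log (1/ε') ≤ 2 D (D−1)² · log M + 5 C(D,2)² · log 2`.

The note counts UNORDERED coincidences `N'`; the symmetrised family has `#𝒞 = 2N'`, giving
`N' log(1/ε') ≤ D(D−1)² log M + (5/8) log 2 · D²(D−1)²` with `(5/8) log 2 = 0.4332… < 0.44`, i.e.
exactly display (AE) of the note (whose pen proof used the exponent `m₁ = (D−1)(D−2)(2D−1)`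
and dropped a negative `log |a|` term; the kernel route uses `2D(D−1)²`, where the `log |a|`
terms cancel exactly — same constant).

Contents (prefix `soloAE_`):
* `soloAE_norm_sub_sub_smul_le` — two served points: `‖(r s₁ − r s₂) − (s₁ − s₂) ξ‖ ≤ 2ε`;
* `soloAE_coincidence_estimate` — for one coincidence, with `d₁ = r s₁ − r s₂`,
  `d₂ = r s₃ − r s₄`: `d₁² ≠ d₂²` and `‖d₁² − d₂²‖ ≤ 8 (K‖ξ‖ + 1) ε` (via
  `d₁² − d₂² = (d₁ − d₂)(d₁ + d₂)`, `‖d₁ − d₂‖ ≤ 4ε`, `‖d₁ + d₂‖ ≤ 2(K‖ξ‖+1)`, and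
  `d₁ + d₂ ≠ 0` because `‖2(s₁−s₂)ξ‖ ≥ 2‖ξ‖ ≥ 8ε > 4ε`);
* `soloAE_pair_eq_pair` — a served pair is recovered from its root pair `{ι s₁, ι s₂}`;
* `soloAE_lemmaAE` — the lemma: the root-pair map `c ↦ ({ι s₁, ι s₂}, {ι s₃, ι s₄})` is
  injective on `𝒞` and lands in the finset `T` of ordered pairs of `2`-subsets with distinct,
  `ε'`-close `θ`-values (`θ {i,j} = (ρ i − ρ j)²`, `soloSD_theta_pair`), so `#𝒞 ≤ #T`, and
  `soloAE_card_mul_log_le` bounds `#T · log(1/ε')`; if `ε' > 1` the left side is `≤ 0 ≤` the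
  right side (`M ≥ 1` as `|a| ≥ 1`, `Polynomial.one_le_mahlerMeasure_of_one_le_norm_leadingCoeff`).

What this is NOT.  Lemma AE is one input of the seat's pen-and-paper THEOREMS AE-1 / AE-2 on the
node `RoyAdditiveDirichletExponent` (small value estimates for the additive group,
[cite: Roy2010, Thm 1.1, Thm 1.2, Cor 3.2]); those theorems ALSO need the served-set lemma, the
endgame lemma and Roy's Cor 3.2 / Thm 1.2, none of which is in the kernel, and nothing here bears
on `Literature.Periods.SchanuelConjecture` (the seat's verdict, no path, is unchanged).  The
mathematics is elementary and claimed by no one as new; Mathlib-only apart from the two imported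
seat files; no literature hypothesis; axioms the standard three.
-/

namespace Summit.Schanuel.Schanuel.Theorems

open Finset

section Coincidences

variable {D : ℕ}

/-- Two approximations `‖r s − (s ξ + η)‖ ≤ ε` give `‖(r s₁ − r s₂) − (s₁ − s₂) ξ‖ ≤ 2 ε`. -/
theorem soloAE_norm_sub_sub_smul_le (r : ℕ → ℂ) (ξ η : ℂ) {ε : ℝ} {s₁ s₂ : ℕ}
    (h₁ : ‖r s₁ - (s₁ * ξ + η)‖ ≤ ε) (h₂ : ‖r s₂ - (s₂ * ξ + η)‖ ≤ ε) :
    ‖(r s₁ - r s₂) - ((s₁ : ℂ) - s₂) * ξ‖ ≤ 2 * ε := by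
  have : (r s₁ - r s₂) - ((s₁ : ℂ) - s₂) * ξ = (r s₁ - (s₁ * ξ + η)) - (r s₂ - (s₂ * ξ + η)) := by
    ring
  rw [this]
  exact (norm_sub_le _ _).trans (by linarith)

/-- **Coincidence estimate.**  For an inexact additive coincidence `s₁ − s₂ = s₃ − s₄` of served
integers in `[0, K]` (approximations within `ε ≤ 1/2`, `4 ε ≤ ‖ξ‖`): the squared
differences `d₁² = (r s₁ − r s₂)²` and `d₂² = (r s₃ − r s₄)²` are distinct and
`‖d₁² − d₂²‖ ≤ 8 (K‖ξ‖ + 1) ε`. -/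
theorem soloAE_coincidence_estimate (r : ℕ → ℂ) (ξ η : ℂ) (K : ℕ) {ε : ℝ} (hε0 : 0 < ε)
    (hε1 : ε ≤ 1 / 2) (hεξ : 4 * ε ≤ ‖ξ‖) {s₁ s₂ s₃ s₄ : ℕ}
    (h₁ : ‖r s₁ - (s₁ * ξ + η)‖ ≤ ε) (h₂ : ‖r s₂ - (s₂ * ξ + η)‖ ≤ ε)
    (h₃ : ‖r s₃ - (s₃ * ξ + η)‖ ≤ ε) (h₄ : ‖r s₄ - (s₄ * ξ + η)‖ ≤ ε)
    (h₂₁ : s₂ < s₁) (h₁K : s₁ ≤ K) (hdiff : s₁ + s₄ = s₃ + s₂)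
    (hinex : r s₁ - r s₂ ≠ r s₃ - r s₄) :
    (r s₁ - r s₂) ^ 2 ≠ (r s₃ - r s₄) ^ 2 ∧
      ‖(r s₁ - r s₂) ^ 2 - (r s₃ - r s₄) ^ 2‖ ≤ 8 * (K * ‖ξ‖ + 1) * ε := by
  -- the common difference `n = s₁ − s₂ = s₃ − s₄` as a complex number
  have hn : ((s₃ : ℂ) - s₄) = (s₁ : ℂ) - s₂ := by
    have h := congrArg (fun m : ℕ => (m : ℂ)) hdiff
    simp only [Nat.cast_add] at h
    linear_combination -h
  have he₁ := soloAE_norm_sub_sub_smul_le r ξ η h₁ h₂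
  have he₂ := soloAE_norm_sub_sub_smul_le r ξ η h₃ h₄
  rw [hn] at he₂
  have hnK : ‖((s₁ : ℂ) - s₂) * ξ‖ ≤ K * ‖ξ‖ := by
    rw [norm_mul, ← Nat.cast_sub h₂₁.le, Complex.norm_natCast]
    exact mul_le_mul_of_nonneg_right (by exact_mod_cast (Nat.sub_le _ _).trans h₁K)
      (norm_nonneg _)
  have hn1 : 2 * ‖ξ‖ ≤ ‖2 * (((s₁ : ℂ) - s₂) * ξ)‖ := by
    rw [norm_mul, Complex.norm_two, norm_mul, ← Nat.cast_sub h₂₁.le, Complex.norm_natCast]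
    have : (1 : ℝ) ≤ ((s₁ - s₂ : ℕ) : ℝ) := by exact_mod_cast Nat.sub_pos_of_lt h₂₁
    nlinarith [norm_nonneg ξ]
  -- `d₁ − d₂` and `d₁ + d₂`
  have hsub : ‖(r s₁ - r s₂) - (r s₃ - r s₄)‖ ≤ 4 * ε := by
    have : (r s₁ - r s₂) - (r s₃ - r s₄) = ((r s₁ - r s₂) - ((s₁ : ℂ) - s₂) * ξ)
        - ((r s₃ - r s₄) - ((s₁ : ℂ) - s₂) * ξ) := by ring
    rw [this]
    exact (norm_sub_le _ _).trans (by linarith)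
  have hadd_eq : (r s₁ - r s₂) + (r s₃ - r s₄) = ((r s₁ - r s₂) - ((s₁ : ℂ) - s₂) * ξ)
      + ((r s₃ - r s₄) - ((s₁ : ℂ) - s₂) * ξ) + 2 * (((s₁ : ℂ) - s₂) * ξ) := by ring
  have hadd : ‖(r s₁ - r s₂) + (r s₃ - r s₄)‖ ≤ 2 * (K * ‖ξ‖ + 1) := by
    rw [hadd_eq]
    refine (norm_add_le _ _).trans ?_
    have := (norm_add_le ((r s₁ - r s₂) - ((s₁ : ℂ) - s₂) * ξ)
      ((r s₃ - r s₄) - ((s₁ : ℂ) - s₂) * ξ))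
    rw [norm_mul, Complex.norm_two]
    linarith
  have hadd_ne : (r s₁ - r s₂) + (r s₃ - r s₄) ≠ 0 := by
    intro h0
    rw [hadd_eq, add_eq_zero_iff_neg_eq] at h0
    have := (norm_add_le ((r s₁ - r s₂) - ((s₁ : ℂ) - s₂) * ξ)
      ((r s₃ - r s₄) - ((s₁ : ℂ) - s₂) * ξ))
    rw [← h0, norm_neg] at hn1
    linarith
  refine ⟨fun h => ?_, ?_⟩
  · have : ((r s₁ - r s₂) - (r s₃ - r s₄)) * ((r s₁ - r s₂) + (r s₃ - r s₄)) = 0 := by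
      linear_combination h
    rcases mul_eq_zero.mp this with h0 | h0
    · exact hinex (sub_eq_zero.mp h0)
    · exact hadd_ne h0
  · have : (r s₁ - r s₂) ^ 2 - (r s₃ - r s₄) ^ 2 =
        ((r s₁ - r s₂) - (r s₃ - r s₄)) * ((r s₁ - r s₂) + (r s₃ - r s₄)) := by ring
    rw [this, norm_mul]
    have h4 : 0 ≤ 4 * ε := by linarith
    calc ‖(r s₁ - r s₂) - (r s₃ - r s₄)‖ * ‖(r s₁ - r s₂) + (r s₃ - r s₄)‖
        ≤ (4 * ε) * (2 * (K * ‖ξ‖ + 1)) :=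
          mul_le_mul hsub hadd (norm_nonneg _) h4
      _ = 8 * (K * ‖ξ‖ + 1) * ε := by ring

/-- Served pairs are recovered from their root pairs: `{ι s₁, ι s₂} = {ι t₁, ι t₂}` with
`s₂ < s₁`, `t₂ < t₁` in `S` and `ι` injective on `S` forces `(s₁, s₂) = (t₁, t₂)`. -/
theorem soloAE_pair_eq_pair {ι : ℕ → Fin D} {S : Finset ℕ} (hι : Set.InjOn ι S)
    {s₁ s₂ t₁ t₂ : ℕ} (hs₁ : s₁ ∈ S) (hs₂ : s₂ ∈ S) (ht₁ : t₁ ∈ S) (ht₂ : t₂ ∈ S)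
    (hs : s₂ < s₁) (ht : t₂ < t₁)
    (h : ({ι s₁, ι s₂} : Finset (Fin D)) = {ι t₁, ι t₂}) : s₁ = t₁ ∧ s₂ = t₂ := by
  have m₁ : ι s₁ ∈ ({ι t₁, ι t₂} : Finset (Fin D)) := h ▸ by simp
  have m₂ : ι s₂ ∈ ({ι t₁, ι t₂} : Finset (Fin D)) := h ▸ by simp
  have n₁ : ι t₁ ∈ ({ι s₁, ι s₂} : Finset (Fin D)) := h ▸ by simp
  simp only [Finset.mem_insert, Finset.mem_singleton] at m₁ m₂ n₁
  have e₁ : s₁ = t₁ ∨ s₁ = t₂ := m₁.imp (hι hs₁ ht₁) (hι hs₁ ht₂)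
  have e₂ : s₂ = t₁ ∨ s₂ = t₂ := m₂.imp (hι hs₂ ht₁) (hι hs₂ ht₂)
  have e₃ : t₁ = s₁ ∨ t₁ = s₂ := n₁.imp (hι ht₁ hs₁) (hι ht₁ hs₂)
  omega

/-- **LEMMA AE (kernel form).**  Setting: `F ∈ ℤ[X]` non-zero with `natDegree F = D`, roots
`ρ` (enumerated with multiplicity); `ξ, η ∈ ℂ`, `K ∈ ℕ`, `0 < ε ≤ 1/2` with `4 ε ≤ ‖ξ‖`; a finset
`S` of naturals `≤ K` SERVED by roots via `ι` (injective on `S`, `‖ρ (ι s) − (s ξ + η)‖ ≤ ε`).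
Let `𝒞` be any finset of ORDERED inexact additive coincidences `c = ((s₁, s₂), (s₃, s₄))`:
all `sᵢ ∈ S`, `s₂ < s₁`, `s₄ < s₃`, `s₁ − s₂ = s₃ − s₄` (stated as `s₁ + s₄ = s₃ + s₂`) and
`ρ (ι s₁) − ρ (ι s₂) ≠ ρ (ι s₃) − ρ (ι s₄)` (which forces `(s₁, s₂) ≠ (s₃, s₄)`).  Then, with
`ε' = 8 (K‖ξ‖ + 1) ε` and `M` the Mahler measure of `F` over `ℂ`,
`#𝒞 · log (1/ε') ≤ 2 D (D−1)² · log M + 5 C(D,2)² · log 2`.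
(The note's `N'` counts unordered coincidences, i.e. `#𝒞 = 2 N'` for the symmetrised family,
which gives `N' log(1/ε') ≤ D(D−1)² log M + (5/8) log 2 · D²(D−1)²`, `(5/8) log 2 < 0.4333`.) -/
theorem soloAE_lemmaAE (F : Polynomial ℤ) (hF : F ≠ 0) (hD : F.natDegree = D)
    (ρ : Fin D → ℂ) (hρ : univ.val.map ρ = (F.map (Int.castRingHom ℂ)).roots)
    (ξ η : ℂ) (K : ℕ) {ε : ℝ} (hε0 : 0 < ε) (hε1 : ε ≤ 1 / 2) (hεξ : 4 * ε ≤ ‖ξ‖)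
    (S : Finset ℕ) (hSK : ∀ s ∈ S, s ≤ K) (ι : ℕ → Fin D) (hι : Set.InjOn ι S)
    (hserved : ∀ s ∈ S, ‖ρ (ι s) - (s * ξ + η)‖ ≤ ε)
    (𝒞 : Finset ((ℕ × ℕ) × (ℕ × ℕ)))
    (hS : ∀ c ∈ 𝒞, c.1.1 ∈ S ∧ c.1.2 ∈ S ∧ c.2.1 ∈ S ∧ c.2.2 ∈ S)
    (hord : ∀ c ∈ 𝒞, c.1.2 < c.1.1 ∧ c.2.2 < c.2.1)
    (hdiff : ∀ c ∈ 𝒞, c.1.1 + c.2.2 = c.2.1 + c.1.2)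
    (hinex : ∀ c ∈ 𝒞, ρ (ι c.1.1) - ρ (ι c.1.2) ≠ ρ (ι c.2.1) - ρ (ι c.2.2)) :
    (#𝒞 : ℝ) * Real.log (1 / (8 * (K * ‖ξ‖ + 1) * ε)) ≤
      ((2 * D * (D - 1) ^ 2 : ℕ) : ℝ) * Real.log (F.map (Int.castRingHom ℂ)).mahlerMeasure
        + ((5 * (D.choose 2) ^ 2 : ℕ) : ℝ) * Real.log 2 := by
  classical
  -- the squared-difference values and the target finset of ordered pairs of 2-subsets
  obtain ⟨θ, hθ⟩ : ∃ θ : Finset (Fin D) → ℂ, ∀ p, θ p = (∑ i ∈ p, ρ i) ^ 2 - 4 * ∏ i ∈ p, ρ i :=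
    ⟨_, fun _ => rfl⟩
  have hε' : 0 < 8 * (K * ‖ξ‖ + 1) * ε := by positivity
  obtain ⟨T, hT⟩ :
      ∃ T : Finset ({p : Finset (Fin D) // p.card = 2} × {p : Finset (Fin D) // p.card = 2}),
      T = univ.filter (fun q => ∃ c ∈ 𝒞, q.1.1 = {ι c.1.1, ι c.1.2} ∧
        q.2.1 = {ι c.2.1, ι c.2.2}) := ⟨_, rfl⟩
  -- each coincidence: distinct root pair entries, the estimate
  have hpair : ∀ c ∈ 𝒞, ι c.1.1 ≠ ι c.1.2 ∧ ι c.2.1 ≠ ι c.2.2 := by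
    intro c hc
    obtain ⟨h1, h2, h3, h4⟩ := hS c hc
    exact ⟨fun h => (hord c hc).1.ne' (hι h1 h2 h), fun h => (hord c hc).2.ne' (hι h3 h4 h)⟩
  have hest : ∀ c ∈ 𝒞, θ {ι c.1.1, ι c.1.2} ≠ θ {ι c.2.1, ι c.2.2} ∧
      ‖θ {ι c.1.1, ι c.1.2} - θ {ι c.2.1, ι c.2.2}‖ ≤ 8 * (K * ‖ξ‖ + 1) * ε := by
    intro c hc
    obtain ⟨h1, h2, h3, h4⟩ := hS c hc
    rw [hθ, hθ, soloSD_theta_pair ρ (hpair c hc).1, soloSD_theta_pair ρ (hpair c hc).2]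
    exact soloAE_coincidence_estimate (fun s => ρ (ι s)) ξ η K hε0 hε1 hεξ (hserved _ h1)
      (hserved _ h2) (hserved _ h3) (hserved _ h4) (hord c hc).1 (hSK _ h1) (hdiff c hc)
      (hinex c hc)
  -- `T` qualifies for the analytic core
  have hTok : ∀ q ∈ T, θ q.1.1 ≠ θ q.2.1 ∧ ‖θ q.1.1 - θ q.2.1‖ ≤ 8 * (K * ‖ξ‖ + 1) * ε := by
    intro q hq
    rw [hT, Finset.mem_filter] at hq
    obtain ⟨c, hc, hq1, hq2⟩ := hq.2
    rw [hq1, hq2]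
    exact hest c hc
  -- `#𝒞 ≤ #T`: the root-pair map is injective on `𝒞` and lands in (the image of) `T`
  have hcard : #𝒞 ≤ #T := by
    have hinj : Set.InjOn (fun c : (ℕ × ℕ) × (ℕ × ℕ) =>
        (({ι c.1.1, ι c.1.2} : Finset (Fin D)), ({ι c.2.1, ι c.2.2} : Finset (Fin D)))) ↑𝒞 := by
      intro c hc c' hc' h
      simp only [Prod.mk.injEq] at h
      obtain ⟨h1, h2, h3, h4⟩ := hS c hc
      obtain ⟨h1', h2', h3', h4'⟩ := hS c' hc'
      obtain ⟨e1, e2⟩ := soloAE_pair_eq_pair hι h1 h2 h1' h2' (hord c hc).1 (hord c' hc').1 h.1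
      obtain ⟨e3, e4⟩ := soloAE_pair_eq_pair hι h3 h4 h3' h4' (hord c hc).2 (hord c' hc').2 h.2
      exact Prod.ext (Prod.ext e1 e2) (Prod.ext e3 e4)
    have himg : 𝒞.image (fun c : (ℕ × ℕ) × (ℕ × ℕ) =>
        (({ι c.1.1, ι c.1.2} : Finset (Fin D)), ({ι c.2.1, ι c.2.2} : Finset (Fin D)))) ⊆
        T.image (fun q => (q.1.1, q.2.1)) := by
      intro x hx
      rw [Finset.mem_image] at hx ⊢
      obtain ⟨c, hc, rfl⟩ := hx
      refine ⟨(⟨{ι c.1.1, ι c.1.2}, Finset.card_pair (hpair c hc).1⟩,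
        ⟨{ι c.2.1, ι c.2.2}, Finset.card_pair (hpair c hc).2⟩), ?_, rfl⟩
      rw [hT, Finset.mem_filter]
      exact ⟨Finset.mem_univ _, c, hc, rfl, rfl⟩
    calc #𝒞 = #(𝒞.image (fun c : (ℕ × ℕ) × (ℕ × ℕ) =>
          (({ι c.1.1, ι c.1.2} : Finset (Fin D)), ({ι c.2.1, ι c.2.2} : Finset (Fin D))))) :=
          (Finset.card_image_of_injOn hinj).symm
      _ ≤ #(T.image (fun q => (q.1.1, q.2.1))) := Finset.card_le_card himg
      _ ≤ #T := Finset.card_image_le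
  -- the analytic core for `T`, then pass from `#T` to `#𝒞`
  have hcore := soloAE_card_mul_log_le F hF hD ρ hρ θ hθ hε' T hTok
  have hMge : 1 ≤ (F.map (Int.castRingHom ℂ)).mahlerMeasure := by
    refine Polynomial.one_le_mahlerMeasure_of_one_le_norm_leadingCoeff ?_
    rw [Polynomial.leadingCoeff_map_of_injective (Int.castRingHom ℂ).injective_int,
      eq_intCast, Complex.norm_intCast]
    exact_mod_cast Int.one_le_abs (Polynomial.leadingCoeff_ne_zero.mpr hF)
  have hRHS : 0 ≤ ((2 * D * (D - 1) ^ 2 : ℕ) : ℝ) *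
      Real.log (F.map (Int.castRingHom ℂ)).mahlerMeasure
        + ((5 * (D.choose 2) ^ 2 : ℕ) : ℝ) * Real.log 2 := by
    have := Real.log_nonneg hMge
    have := Real.log_pos one_lt_two
    positivity
  by_cases hlog : 0 ≤ Real.log (1 / (8 * (K * ‖ξ‖ + 1) * ε))
  · exact (mul_le_mul_of_nonneg_right (by exact_mod_cast hcard) hlog).trans hcore
  · exact (mul_nonpos_iff.mpr (Or.inl ⟨Nat.cast_nonneg _, (not_le.mp hlog).le⟩)).trans hRHS

end Coincidences

end Summit.Schanuel.Schanuel.Theorems
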